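import Literature.MathematicalPhysics.QuantumFieldTheory.Balaban1983to89.Node00.OpsYDeltaALocalAgree
import Literature.MathematicalPhysics.QuantumFieldTheory.Balaban1983to89.B9CubeBondRowAgreementNearH
import Literature.MathematicalPhysics.QuantumFieldTheory.Balaban1983to89.B9WalkLettersCoordsS
import Literature.MathematicalPhysics.QuantumFieldTheory.Balaban1983to89.B9Eq340TaxiTelescope
import Literature.MathematicalPhysics.QuantumFieldTheory.Balaban1983to89.B9Eq3104CutoffCommutatorSizes
import Literature.MathematicalPhysics.QuantumFieldTheory.Balaban1983to89.Node00.OpsYNablaBridge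
import Literature.MathematicalPhysics.QuantumFieldTheory.Balaban1983to89.Node00.OpsYGauge
import Literature.MathematicalPhysics.QuantumFieldTheory.Balaban1983to89.B9TorusLabelDistanceToolkit

/-!
# `Balaban1983to89.B9DeltaALocalReadingsInCollarY` — T. Bałaban, *Propagators for lattice gauge theories in a background field*, Commun. Math. Phys. **99** (1985)
# 389–434 [Balaban1985BackgroundPropagators] p. 410 L14–15 («A propagator G′_□ depends on U restricted to Ω₀(□) ⊂ □̃⁵») and p. 408 («Ω_j(□) = □̃⁴»): EVERYTHING
# THE PADDED LOCAL OPERATOR `M_χ Δ_{a,□}(U) M_χ` READS LIES IN A COLLAR OF `□̃(c)` — node00-def-Y's agreement predicate `AgreeNearBY (cubeDomY x c) χ U U′`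
# (A-3, `OpsYDeltaALocalAgree`) DISCHARGED from «`U = U′` on every bond within torus sup-distance `K ≥ 4L^{j(c)+2}` of `□̃(c)`»

statement-level skeleton of published theorems with citation tags; proofs where landed; nothing here is a claim about the Yang–Mills mass gap

WHY THIS FILE (cell context).  def-Y's A-3 proves `padDeltaALocY … U = padDeltaALocY … U′` from `AgreeNearBY i D χ U U′`, a predicate phrased over KERNEL SUPPORTS
(«the geometric inclusion — kernel supports ↦ cube neighbourhoods — is the cube cover's, NOT asserted here»; def-Y on the bus: «YOUR side», with the reading radii
(P) ≤ 1 step, (Q′) inside the blocks of `□̃`, (Q) ≤ `2L^{j(□)+2}`).  This file is that inclusion at W-a's `D = cubeDomY x c`: each of the five clauses reads only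
bonds whose endpoints are within `K` of a site of `□̃(c)`, for any `K ≥ 4L^{j(c)+2}` — (i) the bonds at `□̃` and one step back (radius 1) and the averaging runs of
`Δ′_a`'s kernel through the block corners (inside the blocks of `□̃`, radius `L^{j+1}`), (ii) `supp χ` (radius 1), (iii) the plaquettes through `supp χ` (radius 3),
(iv) the `Q(U)`-stencil taxi runs (lit-balaban r05: ends in the double block of an index bond of level `≤ j(c) + 2`, reach `< 2L^{j(ι)}`, hence `≤ 4L^{j+2} − 2` by
the triangle inequality), (v) the `Q′`-runs `c(s) ⇄ z` (inside the block, radius `L^{j+1}`).  The consumer is the composition «(3.35) on the covering class cube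
(`B9Eq335CubeDomCoverWideP`) ⇒ `hloc`» (this seat), where `K = (L − 4)·S_{j(c)} ≥ 4L^{j(c)+2}`.

WHAT IS PROVED (sorry-free; 0 `def`; geometry of supports — nothing of [B9] asserted).
* §1 `agree_of_near`, `agreeRunY_of_near` (a taxi run between two sites of `D` at distance `≤ K` reads only collar bonds — `supDist_rungSites_taxiSteps_le`),
  ★ `bondAgreeY_of_near` (ii), ★ `plaqAgreeY_of_near ∕ plaqAgreeNearY_of_near` (iii; `curlK_ne_zero_imp`, `edgeY`), ★ `uboxY_agree_of_near` (i, first half).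
* §2 block geometry: `supDist_symm_le_of_abs_le`, `abs_corner_sub_le`, `abs_sub_le_of_blkOf_eq`, `mem_cubeDomY_iff_blkOf`, `blkCornerY_mem_cubeDomY`,
  `blkOf_level_le_of_mem_cubeDomY`, ★ `qpRuns_agree_of_near` (v; `qpK_ne_zero_imp`), ★ `avgRuns_agree_of_near` (i, second half; `avgCoeffY ≠ 0 ⇒` same block).
* §3 ★ `supDist_embIter_src_le_of_qK_ne_zero` (r05's reach through `cdist`), ★ `lvl_le_of_qK_ne_zero_of_mem_cubeDomY` (`j(ι) ≤ j(c) + 2`), ★★ `qRuns_agree_of_near` (iv).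
* §4 ★★★ **`agreeNearBY_of_agree_on_collar`** (`4L^{j(c)+2} ≤ K`, `χ(b) ≠ 0 ⇒ e(b₋) ∈ cubeDomY x c`, agreement on the `K`-collar ⇒ `AgreeNearBY x.toKIdx (cubeDomY x c) χ U U′`),
  `circAbs_le_of_supDist_le` (the collar in the label form of the class-cube cover).
HONEST SCOPE.  Support geometry + bookkeeping over landed definitions (def-Y MODULES, W-a's `cubeDomY`, r03∕p21∕r05 geometry BY NAME); NOT a node discharge, NOT
summit progress; count-neutral; nothing continuum ∕ OS ∕ mass gap ∕ Clay.  Cell `pub-ymgap` (HUMAN RULING D-0062), Track A node N06 [B9], seat `pub-ymgap-dag-n06-j`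
(harness re-seat gen 23), 2026-08-28.  NEW file; nothing landed is modified.  Net new unproved facts: 0.
-/

namespace Literature.MathematicalPhysics.QuantumFieldTheory.Balaban1983to89.B9DeltaALocalReadingsInCollarY

open Literature.MathematicalPhysics.QuantumFieldTheory.Balaban1983to89
open B6KLevelCensusIndexV1 B9BackgroundsKLevelV1 B6GlobalChartV1 Node00
open Literature.MathematicalPhysics.QuantumFieldTheory.Balaban1983to89.LatticeFieldCalculus (supDist)
open Literature.MathematicalPhysics.QuantumFieldTheory.Balaban1983to89.B3TorusRadialSums (cdist cdist_le_supDist cdist_neg supDist_comm)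
open Literature.MathematicalPhysics.QuantumFieldTheory.Balaban1983to89.B6BlockHolderLipschitzV1 (supDist_le_of_cdist_le)
open Literature.MathematicalPhysics.QuantumFieldTheory.Balaban1983to89.B4TorusKernel.MultiPeriod (circAbs)
open Literature.MathematicalPhysics.QuantumFieldTheory.Balaban1983to89.B9TorusLabelDistanceToolkit

/-! ## §1 The readings of `Δ_{a,□}` near `□̃(c)`: the plaquette ∕ bond ∕ box-shift clauses -/

section Readings

open Literature.MathematicalPhysics.QuantumFieldTheory.Balaban1983to89.Node00.OpsYLocalInverseAgree (AgreeNearY AgreeRunY taxiBondsY)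
open Literature.MathematicalPhysics.QuantumFieldTheory.Balaban1983to89.Node00.OpsYDeltaALocalAgree (AgreeNearBY BondAgreeY PlaqAgreeNearY PlaqAgreeY)
open Literature.MathematicalPhysics.QuantumFieldTheory.Balaban1983to89.B9WalkLettersCoordsS (cubeDomY cubeBlksY four_le_P)
open Literature.MathematicalPhysics.QuantumFieldTheory.Balaban1983to89.B6Cover236MultiLevelBlocks (cubes)
open Literature.MathematicalPhysics.QuantumFieldTheory.Balaban1983to89.B9PinMembersKLevelV1 (MemberY)
open Literature.MathematicalPhysics.QuantumFieldTheory.Balaban1983to89.B9Eq340TaxiTelescope (supDist_rungSites_taxiSteps_le)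
open Literature.MathematicalPhysics.QuantumFieldTheory.Balaban1983to89.B9Eq3104CutoffCommutatorSizes (curlK_ne_zero_imp qpK_ne_zero_imp qpsK_ne_zero_imp)

variable {d ℓ : ℕ} {hd : 1 ≤ d + 1} {hL : Odd (ℓ + 1) ∧ 1 < ℓ + 1} {b₀ b₁ : ℝ} {Mstar : ℕ}
variable {𝔸 : Type} [NormedRing 𝔸] [NormedAlgebra ℂ 𝔸] [CompleteSpace 𝔸]
variable (i : KIdx d ℓ hd hL b₀ b₁)

/-- ★ AGREEMENT ON THE COLLAR GIVES AGREEMENT ON EVERY BOND WITHIN `K` OF A SITE OF `D` — packaged: if `U = U′` on every bond whose two endpoints are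
within torus sup-distance `K` of (the torus image of) a site of `D`, then `U = U′` at the bond `(κ, w)` as soon as some `z ∈ D` has `|z − w|_∞ ≤ K` and
`|z − (w + e_κ)|_∞ ≤ K`. (Definition-free restatement used clause by clause below.) [cite: Balaban1985BackgroundPropagators, p.410 L14–15 («U restricted to Ω₀(□)»), bookkeeping] -/
theorem agree_of_near {D : Finset (SiteY i)} {K : ℕ} {U U' : CfgY 𝔸 i}
    (hUU' : ∀ κ w, (∃ z ∈ D, supDist ((boxEquiv i.hN).symm z) w ≤ K ∧ supDist ((boxEquiv i.hN).symm z) (w.shift κ) ≤ K) → U κ w = U' κ w)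
    {z : SiteY i} (hz : z ∈ D) {κ : Fin (d + 1)} {w : Site (PV d ℓ i.m i.K hd hL) 0}
    (h1 : supDist ((boxEquiv i.hN).symm z) w ≤ K) (h2 : supDist ((boxEquiv i.hN).symm z) (w.shift κ) ≤ K) : U κ w = U' κ w :=
  hUU' κ w ⟨z, hz, h1, h2⟩

/-- a taxi run between two sites of `D` at sup-distance `≤ K` reads only bonds within `K` of its start: agreement on the collar gives `AgreeRunY`.
[cite: Balaban1985BackgroundPropagators, (3.40) p.397 (the contours Γ), p.410 L14–15] -/
theorem agreeRunY_of_near {D : Finset (SiteY i)} {K : ℕ} {U U' : CfgY 𝔸 i}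
    (hUU' : ∀ κ w, (∃ z ∈ D, supDist ((boxEquiv i.hN).symm z) w ≤ K ∧ supDist ((boxEquiv i.hN).symm z) (w.shift κ) ≤ K) → U κ w = U' κ w)
    {a b : SiteY i} (ha : a ∈ D) (hb : b ∈ D) (hab : supDist ((boxEquiv i.hN).symm a) ((boxEquiv i.hN).symm b) ≤ K) :
    AgreeRunY i U U' a b := by
  constructor
  · intro r hr
    have h := supDist_rungSites_taxiSteps_le ((boxEquiv i.hN).symm a) ((boxEquiv i.hN).symm b) r hr
    exact agree_of_near i hUU' ha (h.1.trans hab) (h.2.trans hab)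
  · intro r hr
    have hba : supDist ((boxEquiv i.hN).symm b) ((boxEquiv i.hN).symm a) ≤ K := by rw [supDist_comm]; exact hab
    have h := supDist_rungSites_taxiSteps_le ((boxEquiv i.hN).symm b) ((boxEquiv i.hN).symm a) r hr
    exact agree_of_near i hUU' hb (h.1.trans hba) (h.2.trans hba)

/-- the torus image of a box site and a torus site within `n` steps: `|e⁻¹(e x) − w|_∞ = |x − w|_∞`. [cite: Balaban1984PropagatorsII, (2.1) p.224, dictionary] -/
theorem supDist_symm_boxEquiv (x w : Site (PV d ℓ i.m i.K hd hL) 0) :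
    supDist ((boxEquiv i.hN).symm (boxEquiv i.hN x)) w = supDist x w := by
  rw [Equiv.symm_apply_apply]

/-- **CLAUSE (ii) — the bonds of `supp χ`**: if `supp χ` issues from `□̃` (`χ(b) ≠ 0 ⇒ e(b₋) ∈ D`) and `K ≥ 1`, agreement on the collar gives `BondAgreeY`.
[cite: Balaban1985BackgroundPropagators, (3.3) p.390, p.410 L14–15] -/
theorem bondAgreeY_of_near {D : Finset (SiteY i)} {K : ℕ} (hK : 1 ≤ K) {χ : FBondY i → ℝ} (hχD : ∀ b, χ b ≠ 0 → boxEquiv i.hN b.src ∈ D)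
    {U U' : CfgY 𝔸 i}
    (hUU' : ∀ κ w, (∃ z ∈ D, supDist ((boxEquiv i.hN).symm z) w ≤ K ∧ supDist ((boxEquiv i.hN).symm z) (w.shift κ) ≤ K) → U κ w = U' κ w) :
    BondAgreeY i χ U U' := by
  intro b hb
  refine agree_of_near i hUU' (hχD b hb) ?_ ?_
  · rw [Equiv.symm_apply_apply, (B3TorusRadialSums.supDist_eq_zero_iff _ _).2 rfl]; exact Nat.zero_le _
  · rw [Equiv.symm_apply_apply]; exact (supDist_shift_le_one _ _).trans hK

/-- the four edges of a plaquette lie within sup-distance `2` of its base point, endpoints included. [cite: Balaban1985BackgroundPropagators, (3.1) p.390 (∂p), bookkeeping] -/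
theorem plaqAgreeY_of_near {D : Finset (SiteY i)} {K : ℕ} {U U' : CfgY 𝔸 i}
    (hUU' : ∀ κ w, (∃ z ∈ D, supDist ((boxEquiv i.hN).symm z) w ≤ K ∧ supDist ((boxEquiv i.hN).symm z) (w.shift κ) ≤ K) → U κ w = U' κ w)
    {x : Site (PV d ℓ i.m i.K hd hL) 0} (hx : boxEquiv i.hN x ∈ D) {p : PlaqY i} (hp : supDist x p.src ≤ 1) (hK : 3 ≤ K) :
    PlaqAgreeY i U U' p := by
  have h0 : supDist x p.src ≤ K := hp.trans (le_trans (by norm_num) hK)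
  have h1 : ∀ μ, supDist x (p.src.shift μ) ≤ K := fun μ =>
    ((supDist_triangle x p.src _).trans (add_le_add hp (supDist_shift_le_one _ _))).trans (le_trans (by norm_num) hK)
  have h2 : ∀ μ ν, supDist x ((p.src.shift μ).shift ν) ≤ K := fun μ ν =>
    ((supDist_triangle x (p.src.shift μ) _).trans (add_le_add
      ((supDist_triangle x p.src _).trans (add_le_add hp (supDist_shift_le_one _ _))) (supDist_shift_le_one _ _))).trans (by omega)
  refine ⟨?_, ?_, ?_, ?_⟩
  · exact agree_of_near i hUU' hx (by rw [Equiv.symm_apply_apply]; exact h0) (by rw [Equiv.symm_apply_apply]; exact h1 _)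
  · exact agree_of_near i hUU' hx (by rw [Equiv.symm_apply_apply]; exact h0) (by rw [Equiv.symm_apply_apply]; exact h1 _)
  · exact agree_of_near i hUU' hx (by rw [Equiv.symm_apply_apply]; exact h1 _) (by rw [Equiv.symm_apply_apply]; exact h2 _ _)
  · exact agree_of_near i hUU' hx (by rw [Equiv.symm_apply_apply]; exact h1 _) (by rw [Equiv.symm_apply_apply]; exact h2 _ _)

/-- **CLAUSE (iii) — the plaquettes of the Hessian's rows through `supp χ`**: a plaquette `p` with `cocurlK b p ≠ 0` or having `b` as an edge has its base
point within one step of `b₋`; with `e(b₋) ∈ D` and `K ≥ 3`, agreement on the collar gives `PlaqAgreeNearY`. [cite: Balaban1985BackgroundPropagators, (3.10) p.392, (3.4) p.391, p.410 L14–15] -/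
theorem plaqAgreeNearY_of_near {D : Finset (SiteY i)} {K : ℕ} (hK : 3 ≤ K) {χ : FBondY i → ℝ} (hχD : ∀ b, χ b ≠ 0 → boxEquiv i.hN b.src ∈ D)
    {U U' : CfgY 𝔸 i}
    (hUU' : ∀ κ w, (∃ z ∈ D, supDist ((boxEquiv i.hN).symm z) w ≤ K ∧ supDist ((boxEquiv i.hN).symm z) (w.shift κ) ≤ K) → U κ w = U' κ w) :
    PlaqAgreeNearY i χ U U' := by
  intro b p hb hp
  refine plaqAgreeY_of_near i hUU' (hχD b hb) ?_ hK
  -- `b₋ ∈ {p₋, p₋ + e_μ, p₋ + e_ν}`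
  have hcases : b.src = p.src ∨ b.src = p.src.shift p.μ ∨ b.src = p.src.shift p.ν := by
    rcases hp with hc | ⟨m, hm⟩
    · have hc' : curlK i p b ≠ 0 := by
        rw [cocurlK_eq_transpose, Matrix.transpose_apply] at hc; exact hc
      rcases curlK_ne_zero_imp i hc' with h | h | h | h <;> (subst h) <;> simp
    · subst hm
      fin_cases m <;> simp [edgeY]
  rcases hcases with h | h | h
  · rw [h, (B3TorusRadialSums.supDist_eq_zero_iff _ _).2 rfl]; exact Nat.zero_le _
  · rw [h]; exact supDist_shift_le_one' _ _
  · rw [h]; exact supDist_shift_le_one' _ _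

/-- **CLAUSE (i), first half — the bonds at `D` and one step back**: `UboxY U μ z = UboxY U′ μ z` and the same at `z − e_μ`, for `z ∈ D`, `K ≥ 1`.
[cite: Balaban1985BackgroundPropagators, (3.3) p.390, p.410 L14–15] -/
theorem uboxY_agree_of_near {D : Finset (SiteY i)} {K : ℕ} (hK : 1 ≤ K) {U U' : CfgY 𝔸 i}
    (hUU' : ∀ κ w, (∃ z ∈ D, supDist ((boxEquiv i.hN).symm z) w ≤ K ∧ supDist ((boxEquiv i.hN).symm z) (w.shift κ) ≤ K) → U κ w = U' κ w)
    {z : SiteY i} (hz : z ∈ D) (μ : Fin (d + 1)) :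
    UboxY i U μ z = UboxY i U' μ z ∧ UboxY i U μ ((shiftY i μ).symm z) = UboxY i U' μ ((shiftY i μ).symm z) := by
  have hzero : supDist ((boxEquiv i.hN).symm z) ((boxEquiv i.hN).symm z) = 0 := (B3TorusRadialSums.supDist_eq_zero_iff _ _).2 rfl
  constructor
  · exact agree_of_near i hUU' hz (by rw [hzero]; exact Nat.zero_le _) ((supDist_shift_le_one _ _).trans hK)
  · have e : (boxEquiv i.hN).symm ((shiftY i μ).symm z) = ((boxEquiv i.hN).symm z).unshift μ := by
      have h1 := boxEquiv_symm_shiftY i μ ((shiftY i μ).symm z)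
      rw [Equiv.apply_symm_apply] at h1
      have h2 := congrArg (fun w : Site (PV d ℓ i.m i.K hd hL) 0 => w.unshift μ) h1
      simp only [OpsYNablaBridge.unshift_shift] at h2
      exact h2.symm
    show U μ ((boxEquiv i.hN).symm ((shiftY i μ).symm z)) = U' μ ((boxEquiv i.hN).symm ((shiftY i μ).symm z))
    rw [e]
    refine agree_of_near i hUU' hz ?_ ?_
    · have := supDist_shift_le_one' (((boxEquiv i.hN).symm z).unshift μ) μ
      rw [OpsYNablaBridge.shift_unshift] at this
      exact this.trans hK
    · rw [OpsYNablaBridge.shift_unshift, hzero]; exact Nat.zero_le _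

/-! ## §2 Block geometry: the corner and the sites of the averaging block of a site of `□̃(c)` -/

open Literature.MathematicalPhysics.QuantumFieldTheory.Balaban1983to89.B6Geom246MultiLevelBox (bset blkOf coord_bounds blkOf_corner blkOf_eq_iff_blk)

/-- box sites whose labels differ by at most `n` in every coordinate are at torus sup-distance `≤ n`. [cite: Balaban1984PropagatorsII, (2.2) p.224 (torus distance), bookkeeping] -/
theorem supDist_symm_le_of_abs_le {z z' : SiteY i} {n : ℕ} (h : ∀ μ, |z.1 μ - z'.1 μ| ≤ n) :
    supDist ((boxEquiv i.hN).symm z) ((boxEquiv i.hN).symm z') ≤ n := by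
  haveI : NeZero ((PV d ℓ i.m i.K hd hL).sitesPerDir 0) :=
    NeZero.of_pos (lt_trans zero_lt_one ((PV d ℓ i.m i.K hd hL).one_lt_sitesPerDir 0))
  refine supDist_le_of_cdist_le _ _ fun μ => ?_
  have h1 := cdist_sub_le_natAbs (((boxEquiv i.hN).symm z) μ) (((boxEquiv i.hN).symm z') μ)
  rw [val_boxEquiv_symm, val_boxEquiv_symm] at h1
  exact_mod_cast h1.trans (h μ)

/-- a site of the block `s` is within `L^{j(s)} − 1` of the block's corner, coordinatewise. [cite: Balaban1984PropagatorsII, (2.1) p.224 (the blocks), bookkeeping] -/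
theorem abs_corner_sub_le {z : SiteY i} {s : BlkY i} (hz : blkOf i.D.toDomains z = s) (μ : Fin (d + 1)) :
    |(blkCornerY i s).1 μ - z.1 μ| ≤ (((ℓ + 1) ^ s.1.1 - 1 : ℕ) : ℤ) := by
  have hb := coord_bounds i.D.toDomains hz μ
  have h1 : (1 : ℕ) ≤ (ℓ + 1) ^ s.1.1 := Nat.one_le_pow _ _ (Nat.succ_pos ℓ)
  have e : (blkCornerY i s).1 μ = (((ℓ + 1) ^ s.1.1 : ℕ) : ℤ) * s.1.2 μ := rfl
  rw [e, Nat.cast_sub h1, abs_le]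
  obtain ⟨hb1, hb2⟩ := hb
  push_cast at hb1 hb2 ⊢
  constructor <;> linarith

/-- two sites of one block are within `L^{j} − 1` of each other, coordinatewise. [cite: Balaban1984PropagatorsII, (2.1) p.224, bookkeeping] -/
theorem abs_sub_le_of_blkOf_eq {z w : SiteY i} {s : BlkY i} (hz : blkOf i.D.toDomains z = s) (hw : blkOf i.D.toDomains w = s) (μ : Fin (d + 1)) :
    |z.1 μ - w.1 μ| ≤ (((ℓ + 1) ^ s.1.1 - 1 : ℕ) : ℤ) := by
  have hbz := coord_bounds i.D.toDomains hz μ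
  have hbw := coord_bounds i.D.toDomains hw μ
  have h1 : (1 : ℕ) ≤ (ℓ + 1) ^ s.1.1 := Nat.one_le_pow _ _ (Nat.succ_pos ℓ)
  rw [Nat.cast_sub h1, abs_le]
  obtain ⟨hbz1, hbz2⟩ := hbz
  obtain ⟨hbw1, hbw2⟩ := hbw
  push_cast at hbz1 hbz2 hbw1 hbw2 ⊢
  constructor <;> linarith

variable {i} in
/-- `□̃(c) = cubeDomY x c` is BLOCK-SATURATED: membership depends on the block only. [cite: Balaban1985BackgroundPropagators, p.408 («□̃ … a union of blocks»), bookkeeping] -/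
theorem mem_cubeDomY_iff_blkOf (x : MemberY d ℓ hd hL b₀ b₁ Mstar) (c : ↥(cubes x.toKIdx.D.toDomains)) (z : SiteY x.toKIdx) :
    z ∈ cubeDomY x c ↔ blkOf x.toKIdx.D.toDomains z ∈ cubeBlksY x c := by
  unfold B9WalkLettersCoordsS.cubeDomY
  simp only [Finset.mem_filter, Finset.mem_univ, true_and]

/-- the corner of a block of `□̃(c)` lies in `□̃(c)`. [cite: Balaban1985BackgroundPropagators, p.408, bookkeeping] -/
theorem blkCornerY_mem_cubeDomY (x : MemberY d ℓ hd hL b₀ b₁ Mstar) (c : ↥(cubes x.toKIdx.D.toDomains)) {z : SiteY x.toKIdx} (hz : z ∈ cubeDomY x c) :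
    blkCornerY x.toKIdx (blkOf x.toKIdx.D.toDomains z) ∈ cubeDomY x c := by
  rw [mem_cubeDomY_iff_blkOf] at hz ⊢
  have e : blkOf x.toKIdx.D.toDomains (blkCornerY x.toKIdx (blkOf x.toKIdx.D.toDomains z)) = blkOf x.toKIdx.D.toDomains z :=
    blkOf_corner _ _
  rw [e]
  exact hz

/-- the level of a site of `□̃(c)` is at most `j(c) + 1`. [cite: Balaban1984PropagatorsII, (2.36) p.229, p.235 («□̃»); Balaban1985BackgroundPropagators, p.408] -/
theorem blkOf_level_le_of_mem_cubeDomY (x : MemberY d ℓ hd hL b₀ b₁ Mstar) (c : ↥(cubes x.toKIdx.D.toDomains)) {z : SiteY x.toKIdx}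
    (hz : z ∈ cubeDomY x c) : (blkOf x.toKIdx.D.toDomains z).1.1 ≤ c.1.1 + 1 := by
  have h8 : 8 ≤ x.toKIdx.Mh := x.toKIdx.hM8
  have hzblk : blkOf x.toKIdx.D.toDomains z ∈ cubeBlksY x c := (mem_cubeDomY_iff_blkOf x c z).1 hz
  exact (B6Cover236QbigOverlapV1.window_and_congr_of_mem_QbigT x.toKIdx.D hL (le_trans (by norm_num) h8) x.toKIdx.hR2
    (B9Thm37CubeCoverCommutators.one_le_Mh_and_P x.toKIdx).1 (four_le_P x) hzblk).1.2

/-- **CLAUSE (v) — the `Q′` runs through the sites of `□̃(c)`**: for `z ∈ D = □̃(c)` and `s` with `qpK s z ≠ 0 ∨ qpsK z s ≠ 0` (so `s = Δ(z)`), the taxi runs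
`c(s) ⇄ z` stay within `L^{j(c)+1} ≤ K` of their start, a site of `D`. [cite: Balaban1985BackgroundPropagators, (3.21) p.394, (3.40) p.397, p.410 L14–15] -/
theorem qpRuns_agree_of_near (x : MemberY d ℓ hd hL b₀ b₁ Mstar) (c : ↥(cubes x.toKIdx.D.toDomains)) {K : ℕ}
    (hK : (ℓ + 1) ^ (c.1.1 + 1) ≤ K) {U U' : CfgY 𝔸 x.toKIdx}
    (hUU' : ∀ κ w, (∃ z ∈ cubeDomY x c, supDist ((boxEquiv x.toKIdx.hN).symm z) w ≤ K ∧
      supDist ((boxEquiv x.toKIdx.hN).symm z) (w.shift κ) ≤ K) → U κ w = U' κ w)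
    {z : SiteY x.toKIdx} (hz : z ∈ cubeDomY x c) (s : BlkY x.toKIdx) (hs : qpK x.toKIdx s z ≠ 0 ∨ qpsK x.toKIdx z s ≠ 0) :
    AgreeRunY x.toKIdx U U' (blkCornerY x.toKIdx s) z := by
  have hzs : blkOf x.toKIdx.D.toDomains z = s := by
    rcases hs with h | h
    · exact qpK_ne_zero_imp x.toKIdx h
    · exact qpsK_ne_zero_imp x.toKIdx h
  have hcorner : blkCornerY x.toKIdx s ∈ cubeDomY x c := by rw [← hzs]; exact blkCornerY_mem_cubeDomY x c hz
  refine agreeRunY_of_near x.toKIdx hUU' hcorner hz ?_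
  have hlev : s.1.1 ≤ c.1.1 + 1 := by rw [← hzs]; exact blkOf_level_le_of_mem_cubeDomY x c hz
  have hpow : (ℓ + 1) ^ s.1.1 - 1 ≤ K :=
    le_trans (Nat.sub_le _ _) (le_trans (Nat.pow_le_pow_right (Nat.succ_pos ℓ) hlev) hK)
  exact (supDist_symm_le_of_abs_le x.toKIdx (abs_corner_sub_le x.toKIdx hzs)).trans hpow

/-- **CLAUSE (i), second half — the averaging runs of `G′_□`'s kernel**: `avgCoeffY z w ≠ 0` puts `w` in the `L^{lev z}`-block of `z`, so `w`, the block corner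
`c(z)` and `z` all lie in `D = □̃(c)` (block-saturated) within `L^{j(c)+1} ≤ K` of each other: the runs `z ⇄ c(z) ⇄ w` read only collar bonds.
[cite: Balaban1985BackgroundPropagators, (3.19) p.393, (3.24) p.394, (3.40) p.397, p.410 L14–15] -/
theorem avgRuns_agree_of_near (x : MemberY d ℓ hd hL b₀ b₁ Mstar) (c : ↥(cubes x.toKIdx.D.toDomains)) {K : ℕ}
    (hK : (ℓ + 1) ^ (c.1.1 + 1) ≤ K) {U U' : CfgY 𝔸 x.toKIdx}
    (hUU' : ∀ κ w, (∃ z ∈ cubeDomY x c, supDist ((boxEquiv x.toKIdx.hN).symm z) w ≤ K ∧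
      supDist ((boxEquiv x.toKIdx.hN).symm z) (w.shift κ) ≤ K) → U κ w = U' κ w)
    {z : SiteY x.toKIdx} (hz : z ∈ cubeDomY x c) (w : SiteY x.toKIdx) (hzw : avgCoeffY x.toKIdx z w ≠ 0) :
    AgreeRunY x.toKIdx U U' z (cornerY x.toKIdx (levY x.toKIdx z) z) ∧ AgreeRunY x.toKIdx U U' (cornerY x.toKIdx (levY x.toKIdx z) z) w := by
  -- `w` lies in the block of `z`
  have hblk : B4Reflection242.blk ((ℓ + 1) ^ levY x.toKIdx z) w.1 = B4Reflection242.blk ((ℓ + 1) ^ levY x.toKIdx z) z.1 := by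
    by_contra h
    exact hzw (by unfold avgCoeffY B4Reflection242.avgK; rw [if_neg h])
  have hws : blkOf x.toKIdx.D.toDomains w = blkOf x.toKIdx.D.toDomains z := by
    rw [blkOf_eq_iff_blk]; exact hblk
  have hw : w ∈ cubeDomY x c := by rw [mem_cubeDomY_iff_blkOf, hws]; exact (mem_cubeDomY_iff_blkOf x c z).1 hz
  have ecorner : cornerY x.toKIdx (levY x.toKIdx z) z = blkCornerY x.toKIdx (blkOf x.toKIdx.D.toDomains z) := rfl
  rw [ecorner]
  have hcorner : blkCornerY x.toKIdx (blkOf x.toKIdx.D.toDomains z) ∈ cubeDomY x c := blkCornerY_mem_cubeDomY x c hz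
  have hlev : (blkOf x.toKIdx.D.toDomains z).1.1 ≤ c.1.1 + 1 := blkOf_level_le_of_mem_cubeDomY x c hz
  have hpow : (ℓ + 1) ^ (blkOf x.toKIdx.D.toDomains z).1.1 - 1 ≤ K :=
    le_trans (Nat.sub_le _ _) (le_trans (Nat.pow_le_pow_right (Nat.succ_pos ℓ) hlev) hK)
  constructor
  · refine agreeRunY_of_near x.toKIdx hUU' hz hcorner ?_
    rw [supDist_comm]
    exact (supDist_symm_le_of_abs_le x.toKIdx (abs_corner_sub_le x.toKIdx rfl)).trans hpow
  · refine agreeRunY_of_near x.toKIdx hUU' hcorner hw ?_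
    exact (supDist_symm_le_of_abs_le x.toKIdx (abs_corner_sub_le x.toKIdx hws)).trans hpow

/-! ## §3 The `Q(U)`-averaging runs (clause (iv)): lit-balaban r05's stencil reach `2L^{j(y)}`, `j(y) ≤ j(□) + 2` -/

open Literature.MathematicalPhysics.QuantumFieldTheory.Balaban1983to89.B9CubeBondRowAgreementNearH (ends_of_qK_ne_zero torusSupNorm_ends_lt circAbs_le_of_torusSupNorm_lt side_conds)
open Literature.MathematicalPhysics.QuantumFieldTheory.Balaban1983to89.B15DeterminingSets (embIter)
open Literature.MathematicalPhysics.QuantumFieldTheory.Balaban1983to89.B9Eq340StepLasso (rungSites taxiSteps)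

/-- THE STENCIL REACH IN THE SUP-DISTANCE: a fine bond `b` averaged by the index bond `ι` (`qK ι b ≠ 0`) has its source within torus sup-distance
`2L^{j(ι)} − 1` of the base point `x(ι) = embIter j(ι) ι₋` (r05's `torusSupNorm_ends_lt` read through `cdist`). [cite: Balaban1984PropagatorsI, (1.18) p.20 («x(b) … in B^k(b₊)»); Balaban1985BackgroundPropagators, (3.12) p.393] -/
theorem supDist_embIter_src_le_of_qK_ne_zero {ι : IBondY i} {b : FBondY i} (h : qK i ι b ≠ 0) :
    supDist (embIter (ι.1.1 : ℕ) ι.1.2.src) b.src ≤ 2 * (ℓ + 1) ^ (ι.1.1 : ℕ) - 1 := by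
  haveI : NeZero ((PV d ℓ i.m i.K hd hL).sitesPerDir 0) :=
    NeZero.of_pos (lt_trans zero_lt_one ((PV d ℓ i.m i.K hd hL).one_lt_sitesPerDir 0))
  have hJk : (ι.1.1 : ℕ) ≤ i.k := Nat.lt_succ_iff.1 ι.1.1.2
  have hends := ends_of_qK_ne_zero i h
  have htn := (torusSupNorm_ends_lt i hJk ι.1.2 hends).1
  have htn' : B4TorusKernel.MultiPeriod.torusSupNorm (B6MultiLevelBoxOperator.N0 ℓ i.Mh i.k i.P')
      ((toBox i.hN (embIter (ι.1.1 : ℕ) ι.1.2.src)).1 - (toBox i.hN b.src).1) < ((2 * (ℓ + 1) ^ (ι.1.1 : ℕ) : ℕ) : ℝ) := by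
    exact_mod_cast htn
  refine supDist_le_of_cdist_le _ _ fun μ => ?_
  have hc := circAbs_le_of_torusSupNorm_lt htn' μ
  rw [i.hN μ] at hc
  have hval : ((toBox i.hN (embIter (ι.1.1 : ℕ) ι.1.2.src)).1 - (toBox i.hN b.src).1) μ =
      (((embIter (ι.1.1 : ℕ) ι.1.2.src μ).val : ℤ)) - ((b.src μ).val : ℤ) := rfl
  rw [hval] at hc
  have h2 := (cdist_sub_le_circAbs (embIter (ι.1.1 : ℕ) ι.1.2.src μ) (b.src μ)).trans hc
  have h1 : (1 : ℕ) ≤ 2 * (ℓ + 1) ^ (ι.1.1 : ℕ) := le_trans (Nat.one_le_pow _ _ (Nat.succ_pos ℓ)) (Nat.le_mul_of_pos_left _ two_pos)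
  have : ((cdist (embIter (ι.1.1 : ℕ) ι.1.2.src μ - b.src μ) : ℕ) : ℤ) ≤ ((2 * (ℓ + 1) ^ (ι.1.1 : ℕ) - 1 : ℕ) : ℤ) := by
    rw [Nat.cast_sub h1]; exact h2
  exact_mod_cast this

/-- THE LEVEL WINDOW OF THE STENCIL AT `□̃(c)`: a fine bond issuing from `□̃(c)` is averaged only by index bonds of level `j(ι) ≤ j(c) + 2` (`lev_ends_bounds`:
`j(ι) − 1 ≤ lev(b₋) ≤ j(c) + 1`). [cite: Balaban1984PropagatorsII, (2.2)–(2.4) p.224; Balaban1985BackgroundPropagators, p.408 («Ω_j(□) = □̃⁴»)] -/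
theorem lvl_le_of_qK_ne_zero_of_mem_cubeDomY (x : MemberY d ℓ hd hL b₀ b₁ Mstar) (c : ↥(cubes x.toKIdx.D.toDomains)) {ι : IBondY x.toKIdx}
    {b : FBondY x.toKIdx} (hb : boxEquiv x.toKIdx.hN b.src ∈ cubeDomY x c) (h : qK x.toKIdx ι b ≠ 0) : (ι.1.1 : ℕ) ≤ c.1.1 + 2 := by
  have hends := ends_of_qK_ne_zero x.toKIdx h
  obtain ⟨-, -, -, -, hRM⟩ := side_conds x.toKIdx
  have h1 := (B6Ineq2142KLevelV1.lev_ends_bounds x.toKIdx.hN x.toKIdx.D x.toKIdx.hk (le_trans one_le_two x.toKIdx.hk2) hRM ι hends).1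
  have h2 := blkOf_level_le_of_mem_cubeDomY x c hb
  have e : (blkOf x.toKIdx.D.toDomains (boxEquiv x.toKIdx.hN b.src)).1.1 = x.toKIdx.D.lev (toBox x.toKIdx.hN b.src).1 := rfl
  rw [e] at h2
  change (ι.1.1 : ℕ) - 1 ≤ x.toKIdx.D.lev (toBox x.toKIdx.hN b.src).1 at h1
  omega

/-- **CLAUSE (iv) — the `Q(U)`-averaging runs through `supp χ`**: for `χ(b) ≠ 0` (so `e(b₋) ∈ □̃(c)`) and `qK ι b ≠ 0`, every rung bond of the taxi run
`x(ι) → b₋` lies within `2·(2L^{j(ι)} − 1) ≤ 4L^{j(c)+2} − 2 ≤ K` of `b₋`: agreement on the collar gives agreement on the run.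
[cite: Balaban1985BackgroundPropagators, (3.12) p.393, (3.40) p.397, p.408 («Ω_j(□) = □̃⁴»), p.410 L14–15; Balaban1984PropagatorsI, (1.18) p.20] -/
theorem qRuns_agree_of_near (x : MemberY d ℓ hd hL b₀ b₁ Mstar) (c : ↥(cubes x.toKIdx.D.toDomains)) {K : ℕ}
    (hK : 4 * (ℓ + 1) ^ (c.1.1 + 2) ≤ K) {χ : FBondY x.toKIdx → ℝ} (hχD : ∀ b, χ b ≠ 0 → boxEquiv x.toKIdx.hN b.src ∈ cubeDomY x c)
    {U U' : CfgY 𝔸 x.toKIdx}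
    (hUU' : ∀ κ w, (∃ z ∈ cubeDomY x c, supDist ((boxEquiv x.toKIdx.hN).symm z) w ≤ K ∧
      supDist ((boxEquiv x.toKIdx.hN).symm z) (w.shift κ) ≤ K) → U κ w = U' κ w)
    (ι : IBondY x.toKIdx) (b : FBondY x.toKIdx) (hb : χ b ≠ 0) (hq : qK x.toKIdx ι b ≠ 0) :
    ∀ r ∈ rungSites (taxiSteps (List.finRange (d + 1)) (embIter (ι.1.1 : ℕ) ι.1.2.src) b.src) (embIter (ι.1.1 : ℕ) ι.1.2.src),
      U r.2.1 r.1 = U' r.2.1 r.1 := by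
  intro r hr
  have hreach := supDist_embIter_src_le_of_qK_ne_zero x.toKIdx hq
  have hJ := lvl_le_of_qK_ne_zero_of_mem_cubeDomY x c (hχD b hb) hq
  have hpow : 2 * (2 * (ℓ + 1) ^ (ι.1.1 : ℕ) - 1) ≤ K := by
    have h1 : (ℓ + 1) ^ (ι.1.1 : ℕ) ≤ (ℓ + 1) ^ (c.1.1 + 2) := Nat.pow_le_pow_right (Nat.succ_pos ℓ) hJ
    omega
  have hrun := supDist_rungSites_taxiSteps_le (embIter (ι.1.1 : ℕ) ι.1.2.src) b.src r hr
  have hsym : supDist b.src (embIter (ι.1.1 : ℕ) ι.1.2.src) ≤ 2 * (ℓ + 1) ^ (ι.1.1 : ℕ) - 1 := by rw [supDist_comm]; exact hreach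
  refine agree_of_near x.toKIdx hUU' (hχD b hb) ?_ ?_
  · rw [Equiv.symm_apply_apply]
    calc supDist b.src r.1 ≤ supDist b.src (embIter (ι.1.1 : ℕ) ι.1.2.src) + supDist (embIter (ι.1.1 : ℕ) ι.1.2.src) r.1 := supDist_triangle _ _ _
      _ ≤ (2 * (ℓ + 1) ^ (ι.1.1 : ℕ) - 1) + (2 * (ℓ + 1) ^ (ι.1.1 : ℕ) - 1) := add_le_add hsym (hrun.1.trans hreach)
      _ ≤ K := by omega
  · rw [Equiv.symm_apply_apply]
    calc supDist b.src (r.1.shift r.2.1)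
        ≤ supDist b.src (embIter (ι.1.1 : ℕ) ι.1.2.src) + supDist (embIter (ι.1.1 : ℕ) ι.1.2.src) (r.1.shift r.2.1) := supDist_triangle _ _ _
      _ ≤ (2 * (ℓ + 1) ^ (ι.1.1 : ℕ) - 1) + (2 * (ℓ + 1) ^ (ι.1.1 : ℕ) - 1) := add_le_add hsym (hrun.2.trans hreach)
      _ ≤ K := by omega

/-! ## §4 Assembly: `AgreeNearBY` at `□̃(c)` from agreement on the collar -/

/-- ★★★ **`agreeNearBY_of_agree_on_collar` — EVERYTHING `M_χ Δ_{a,□}(U) M_χ` READS LIES IN THE COLLAR OF `□̃(c)`**: if `supp χ` issues from `□̃(c)`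
(`χ(b) ≠ 0 ⇒ e(b₋) ∈ cubeDomY x c`) and two configurations agree on every bond whose endpoints are within torus sup-distance `K ≥ 4L^{j(c)+2}` of a site
of `□̃(c)`, then node00-def-Y's `AgreeNearBY (cubeDomY x c) χ U U′` holds — hence `padDeltaALocY … U = padDeltaALocY … U′` by A-3's
`padDeltaALocY_parSymY_congr`.  Print: «G′_□ … depends on U restricted to Ω₀(□) ⊂ □̃⁵»; the five readings and their radii: bonds at `□̃` (1), plaquettes
through `supp χ` (3), `Q′`-runs inside the blocks of `□̃` (`L^{j+1}`), averaging runs of `Δ′_a`'s kernel (same), `Q`-stencil runs (`4L^{j+2}`, r05).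
[cite: Balaban1985BackgroundPropagators, p.410 L14–15 («depend on U restricted to Ω₀(□) ⊂ □̃⁵»), p.408 («Ω_j(□) = □̃⁴»), (3.12) p.393, (3.21) p.394, (3.40) p.397] -/
theorem agreeNearBY_of_agree_on_collar (x : MemberY d ℓ hd hL b₀ b₁ Mstar) (c : ↥(cubes x.toKIdx.D.toDomains)) {K : ℕ}
    (hK : 4 * (ℓ + 1) ^ (c.1.1 + 2) ≤ K) {χ : FBondY x.toKIdx → ℝ} (hχD : ∀ b, χ b ≠ 0 → boxEquiv x.toKIdx.hN b.src ∈ cubeDomY x c)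
    {U U' : CfgY 𝔸 x.toKIdx}
    (hUU' : ∀ κ w, (∃ z ∈ cubeDomY x c, supDist ((boxEquiv x.toKIdx.hN).symm z) w ≤ K ∧
      supDist ((boxEquiv x.toKIdx.hN).symm z) (w.shift κ) ≤ K) → U κ w = U' κ w) :
    AgreeNearBY x.toKIdx (cubeDomY x c) χ U U' := by
  have hL2 : 1 ≤ (ℓ + 1) ^ (c.1.1 + 2) := Nat.one_le_pow _ _ (Nat.succ_pos ℓ)
  have hK3 : 3 ≤ K := by omega
  have hK1 : 1 ≤ K := by omega
  have hKblk : (ℓ + 1) ^ (c.1.1 + 1) ≤ K :=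
    le_trans (Nat.pow_le_pow_right (Nat.succ_pos ℓ) (Nat.le_succ _)) (le_trans (Nat.le_mul_of_pos_left _ (by norm_num)) hK)
  refine ⟨⟨fun z hz μ => uboxY_agree_of_near x.toKIdx hK1 hUU' hz μ, fun z hz w hzw => avgRuns_agree_of_near x c hKblk hUU' hz w hzw⟩,
    bondAgreeY_of_near x.toKIdx hK1 hχD hUU', plaqAgreeNearY_of_near x.toKIdx hK3 hχD hUU',
    fun ι b hb hq => qRuns_agree_of_near x c hK hχD hUU' ι b hb hq, fun z hz s hs => qpRuns_agree_of_near x c hKblk hUU' hz s hs⟩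

/-- ★ THE COLLAR IN LABEL FORM: a torus site within sup-distance `K` of `e⁻¹ z` is within `circAbs ≤ K` of `z` in every coordinate — the membership
clause of `B9Eq335CubeDomCoverP ∕ …WideP`'s covering class cube. [cite: Balaban1984PropagatorsII, (2.2) p.224 (torus distance), dictionary] -/
theorem circAbs_le_of_supDist_le {z : SiteY i} {w : Site (PV d ℓ i.m i.K hd hL) 0} {K : ℕ}
    (h : supDist ((boxEquiv i.hN).symm z) w ≤ K) (μ : Fin (d + 1)) :
    circAbs ((PV d ℓ i.m i.K hd hL).sitesPerDir 0) (((w μ).val : ℤ) - z.1 μ) ≤ (K : ℤ) := by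
  haveI : NeZero ((PV d ℓ i.m i.K hd hL).sitesPerDir 0) :=
    NeZero.of_pos (lt_trans zero_lt_one ((PV d ℓ i.m i.K hd hL).one_lt_sitesPerDir 0))
  have e : z.1 μ = ((((boxEquiv i.hN).symm z) μ).val : ℤ) := (val_boxEquiv_symm i.hN z μ).symm
  rw [e]
  refine (circAbs_sub_le_cdist (w μ) (((boxEquiv i.hN).symm z) μ)).trans ?_
  have h1 := cdist_le_supDist w ((boxEquiv i.hN).symm z) μ
  rw [supDist_comm] at h1
  exact_mod_cast h1.trans h

end Readings

end Literature.MathematicalPhysics.QuantumFieldTheory.Balaban1983to89.B9DeltaALocalReadingsInCollarY
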